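import Summits.BirchSwinnertonDyer.BirchSwinnertonDyer.Theorems.EisensteinPrimesResidualDevissageNonsplitLambdaIdentity
import Summits.BirchSwinnertonDyer.BirchSwinnertonDyer.Theorems.EisensteinPrimesResidualPairStableLine
import Literature.NumberTheory.EllipticCurves.CastellaGrossiLeeSkinner2022.CharacterGreenbergSelmerDual
import HarnessLib

/-!
# Keller–Yin Thm. 1.4.1's λ-identity at a non-anomalous / non-split datum modulo PUBLISHED character-level facts ONLY:
# `λ(𝔛^{Sf}_f) ≤ λ(𝔛^{Sf}_{θsub}) + λ(𝔛^{Sf}_{θquot})`, with equality iff `𝔛^{Sf}_f` has no `p`-torsion — CGLS22 Prop. 1.2.5 + Cor. 1.2.6 BY NAME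
# (cell `bsd-eis`, seat `bsd-line-x2-p2` gen 6, D-0154 KEY row 5; crux 4 `BSDpOnCellC` stmt-BirchSwinnertonDyer-19034, line b1; sequel of
# `…ResidualDevissageNonsplitLambdaIdentity`)

HONEST FRAMING (cell `bsd-eis`, run/shared/lean/pub/bsd-eis/): bookkeeping on constructed objects; no definition, no new named fact,
no `sorry`, no `Theses` import; nothing about BSD or a main conjecture is asserted; nothing booked; no label or count moves. Helper
`--supports stmt-BirchSwinnertonDyer-19034`; closes no stub. CONDITIONAL on three PUBLISHED named facts of Castella–Grossi–Lee–Skinner,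
Invent. Math. 227 (2022) §1.2 (Rubin 1991 + Hida 2010 + Pollack–Weston A.2 as composed there):
`prop125_characterGrSelmerDual_torsion_muZero_dim` (Prop. 1.2.5: the strict character duals are f.g. `Λ`-torsion with `μ = 0` and
`dim_𝔽 H¹_{𝓕_Gr^S}(K, M_θ[p]) = λ(𝔛_θ^S)`), `cor126_residualCharacter_globalLift` / `…_localSurjective` (Cor. 1.2.6).

## What
* §1 `local_hypotheses_of_embedding` — along an equivariant embedding `j : A ↪ (F/𝒪)(θ)` onto the `p`-torsion, the four local
  hypotheses transfer between `A` and `(F/𝒪)(θ)[p]` (inertia trivial off `S`; `D_{v̄}` not trivial; `D_{v̄}` not cyclotomic).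
* §2 **`lambdaInvariant_le_add_of_prop125_of_cor126`** — for a `Γ_K`-stable line `S ≤ E_K[p]` (`E = W/ℚ` base-changed to a Heegner
  `K`, `(p)` split, `2 < p`, `v̄ ∋ p` strict, `κ` anticyclotomic with generator `γ`, `Sf` = places over `N_E` off `p`) whose two
  characters avoid `{𝟙, ω}` at `v̄`, with Teichmüller characters `θsub`, `θquot` and embeddings `S ↪ (F/𝒪)(θsub)`,
  `E_K[p]/S ↪ (F/𝒪)(θquot)` onto the `p`-torsion, and ANY strict dual data `Dsub`, `Dquot` (`KellerYin2024.GrDualData … v̄ ↑Sf γ`):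
  **`p^{λ(X^{Sf})} · #X^{Sf}[p] = p^{λ(Dsub.X) + λ(Dquot.X)}`**, hence **`λ(X^{Sf}) ≤ λ(Dsub.X) + λ(Dquot.X)`** and
  **`= ` if `X^{Sf}` has no `p`-torsion** — the hypotheses of part 4 (`Dsub.X`, `Dquot.X` f.g. torsion `μ = 0` and `ℤ_p`-free)
  DISCHARGED BY NAME from Prop. 1.2.5 (the freeness via the dimension clause and part 3's count
  `p^λ · #𝔛[p] = #H¹_{𝓕_Gr}[p] = p^λ`).
* §3 **`lambdaInvariant_le_add_of_isResidualPairOver`** — the same keyed on a RESIDUAL PAIR `(θsub, θquot)` of `E_K[p]`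
  (`KellerYin2024.IsResidualPairOver`, the x1 cell's currency; the stable line with embeddings is
  `ResidualPairStableLine.exists_stableLine_of_isResidualPairOver`), the four local hypotheses being stated on the `p`-torsion of
  `(F/𝒪)(θsub)`, `(F/𝒪)(θquot)` exactly as in the named facts.

Reading: at every anticyclotomic Heegner datum whose residual characters BOTH avoid `{𝟙, ω}` at `v̄` — in particular at every
NON-SPLIT multiplicative Eisenstein datum (part 1) — the algebraic λ-relation [ALG-imp] of the Greenberg–Vatsal / CGLS road,
`λ(𝔛^{Sf}_f) = λ(𝔛^{Sf}_φ) + λ(𝔛^{Sf}_ψ)`, holds in the kernel AS AN INEQUALITY `≤` modulo CGLS22 Prop. 1.2.5 + Cor. 1.2.6 [PUB], and as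
an EQUALITY modulo the same plus «`𝔛^{Sf}_f` has no non-zero finite `Λ`-submodule» (CGLS Cor. 1.4.3 / Keller–Yin (e), NOT in the
tree: Pollack–Weston A.2 for `M_E` + `H²(K_Σ/K_∞, E[p^∞]) = 0`). The SPLIT multiplicative / good ANOMALOUS cases are not covered.

References: [CastellaGrossiLeeSkinner2022] §1.2 Prop. 1.2.5, Cor. 1.2.6, §1.4 Props. 1.4.1–1.4.2, Cor. 1.4.3, §1.5 Thm. 1.5.1 (e-print TeX
L681–931; arXiv:2008.02571 Prop. 14, Cor. 15, Props. 17–18, Cor. 19, Thm. 20); [KellerYin2024] Thm. 1.4.1, Lemma 5.1.1, §1.4 display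
(char to f) (arXiv:2402.12781v2); [GreenbergVatsal2000] §2 Prop. (2.8); cell p640605 / part 4 (this seat), `…ResidualPairStableLine` (x1).
-/

set_option autoImplicit false
set_option linter.dupNamespace false -- the summit namespace `…BirchSwinnertonDyer.BirchSwinnertonDyer.Theorems` (Sub = Summit, D-0017) trips it

noncomputable section

open scoped Classical Pointwise

namespace Summit.BirchSwinnertonDyer.BirchSwinnertonDyer.Theorems.ResidualDevissageNonsplitLambdaIdentityOfFacts

open WeierstrassCurve NumberField IsDedekindDomain Field
  Literature.NumberTheory.EllipticCurves Literature.NumberTheory.EllipticCurves.IwasawaAlgebra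
  Literature.NumberTheory.EllipticCurves.GreenbergSelmer
  Literature.NumberTheory.EllipticCurves.GreenbergVatsal2000
  Literature.NumberTheory.GaloisRepresentations IsDedekindDomain.HeightOneSpectrum
  Literature.NumberTheory.EllipticCurves.Rank1Residual Literature.NumberTheory.EllipticCurves.KellerYin2024
  Summit.BirchSwinnertonDyer.Rank1Residual.X11b Summit.BirchSwinnertonDyer.Rank1Residual.X11b.AcSelmer
  Summit.BirchSwinnertonDyer.Rank1Residual.X2.ResidualDevissageModules
  Summit.BirchSwinnertonDyer.BirchSwinnertonDyer.Theorems
  Summit.BirchSwinnertonDyer.BirchSwinnertonDyer.Theorems.ResidualDevissageNonsplitLocalData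
  Summit.BirchSwinnertonDyer.BirchSwinnertonDyer.Theorems.ResidualDevissageNonsplitSurjective
  Summit.BirchSwinnertonDyer.BirchSwinnertonDyer.Theorems.ResidualDevissageNonsplitLambdaIdentity
  Summit.BirchSwinnertonDyer.BirchSwinnertonDyer.Theorems.CharResidualStrictSelmerCount
  Summit.BirchSwinnertonDyer.BirchSwinnertonDyer.Theorems.CumulativeHeegnerInclusionAtThreeResidualDevissage
open Literature.NumberTheory.EllipticCurves.CastellaGrossiLeeSkinner2022
  (cor126_residualCharacter_globalLift cor126_residualCharacter_localSurjective
    prop125_characterGrSelmerDual_torsion_muZero_dim)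

variable {p : ℕ} [hp : Fact p.Prime]

/-! ### §1 The local hypotheses transfer along `j : A ↪ (F/𝒪)(θ)` -/

section Transfer

variable {K : Type} [Field K] (θ : FramedGaloisRep K (padicCoeffIntegers (∅ : Set (PadicAlgCl p))) 1)
  {A : Type} [AddCommGroup A] [DistribMulAction (absoluteGaloisGroup K) A]
  (j : A →+ charModule (∅ : Set (PadicAlgCl p)) θ)
  (hj : ∀ (σ : absoluteGaloisGroup K) (a : A), j (σ • a) = σ • j a) (hinj : Function.Injective j)
  (hrange : ∀ x : charModule (∅ : Set (PadicAlgCl p)) θ, x ∈ j.range ↔ p • x = 0)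
include hj hinj hrange

/-- A subgroup fixing `A` pointwise fixes `(F/𝒪)(θ)[p]` pointwise, and conversely (`j` equivariant onto the `p`-torsion). [folklore] -/
theorem forall_smul_eq_iff_of_embedding (D : Subgroup (absoluteGaloisGroup K)) :
    (∀ g ∈ D, ∀ a : A, g • a = a) ↔
      ∀ g ∈ D, ∀ m : charModule (∅ : Set (PadicAlgCl p)) θ, p • m = 0 → g • m = m := by
  constructor
  · intro h g hg m hm
    obtain ⟨a, rfl⟩ := (hrange m).mpr hm
    rw [← hj, h g hg a]
  · intro h g hg a
    apply hinj
    rw [hj]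
    exact h g hg (j a) ((hrange (j a)).mp ⟨a, rfl⟩)

/-- A subgroup acting on `A` through the mod-`p` cyclotomic character acts so on `(F/𝒪)(θ)[p]`, and conversely. [folklore] -/
theorem forall_smul_eq_cyclotomic_iff_of_embedding [NumberField K] (D : Subgroup (absoluteGaloisGroup K)) :
    (∀ g ∈ D, ∀ a : A, g • a = ((modNCyclotomicCharacter K p g : (ZMod p)ˣ) : ZMod p).val • a) ↔
      ∀ g ∈ D, ∀ m : charModule (∅ : Set (PadicAlgCl p)) θ, p • m = 0 →
        g • m = ((modNCyclotomicCharacter K p g : (ZMod p)ˣ) : ZMod p).val • m := by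
  constructor
  · intro h g hg m hm
    obtain ⟨a, rfl⟩ := (hrange m).mpr hm
    rw [← hj, h g hg a, map_nsmul]
  · intro h g hg a
    apply hinj
    rw [hj, map_nsmul]
    exact h g hg (j a) ((hrange (j a)).mp ⟨a, rfl⟩)

end Transfer

/-! ### §2 The λ-relation modulo CGLS22 Prop. 1.2.5 + Cor. 1.2.6, along a stable line with Teichmüller characters -/

/-- **CGLS22 Prop. 1.2.5 + Cor. 1.2.6 [PUBLISHED] ⟹ `p^{λ(X^{Sf})} · #X^{Sf}[p] = p^{λ(𝔛_sub) + λ(𝔛_quot)}`, so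
`λ(X^{Sf}) ≤ λ(𝔛_sub) + λ(𝔛_quot)`, with EQUALITY if `X^{Sf}` has no `p`-torsion** — Keller–Yin Thm. 1.4.1's λ-identity
(non-anomalous form) along a `Γ_K`-stable line `S ≤ E_K[p]` whose two characters avoid `{𝟙, ω}` at `v̄`. `E = W/ℚ` base-changed to an
imaginary quadratic `K` (Heegner for `N_E`, `(p)` split, `2 < p`), `v̄ ∋ p` the strict place, `κ` anticyclotomic with topological
generator `γ`, `Sf` = the places of `K` over `N_E` off `p`, `X^{Sf} = AcSelmer.XAc E_K p κ v̄ ↑Sf γ` (Keller–Yin's `𝔛^S_f`);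
`θsub`, `θquot` Teichmüller-valued with equivariant embeddings `S ↪ (F/𝒪)(θsub)`, `E_K[p]/S ↪ (F/𝒪)(θquot)` onto the `p`-torsion;
`𝔛_sub = Dsub.X`, `𝔛_quot = Dquot.X` ANY strict dual data (CGLS's `𝔛^S_φ`, `𝔛^S_ψ`). Part 4's hypotheses on the character duals are
supplied BY NAME: f.g. torsion `μ = 0` and the dimension clause from Prop. 1.2.5 (the local hypotheses of the fact transferred along
the embeddings, §1), `ℤ_p`-freeness from the dimension clause and part 3's count. The ONE remaining E-level input of the EQUALITY is
«`X^{Sf}[p] = 0`» (CGLS Cor. 1.4.3), kept as a hypothesis of the last clause.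
[cite: CastellaGrossiLeeSkinner2022, §1.2 Prop. 1.2.5, Cor. 1.2.6, §1.4 Props. 1.4.1–1.4.2, Cor. 1.4.3 (e-print TeX L681–905; arXiv:2008.02571 Prop. 14, Cor. 15, Props. 17–19)]
[cite: KellerYin2024, Thm. 1.4.1 (arXiv:2402.12781v2 TeX L1087–1098)] [cite: GreenbergVatsal2000, §2 Prop. (2.8)] -/
theorem lambdaInvariant_le_add_of_prop125_of_cor126
    (hprop125 : prop125_characterGrSelmerDual_torsion_muZero_dim)
    (hlift : cor126_residualCharacter_globalLift) (hlocal : cor126_residualCharacter_localSurjective)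
    (W : WeierstrassCurve ℚ) [W.IsElliptic]
    (K : Type) [Field K] [NumberField K] (vbar : HeightOneSpectrum (𝓞 K))
    (κ : ZpExtension K p) (γ : absoluteGaloisGroup K) [hγ : Fact (κ.IsTopGenerator γ)]
    (Sf : Finset (HeightOneSpectrum (𝓞 K)))
    (hp2 : 2 < p) (hK : IsImaginaryQuadratic K) (hH : SatisfiesHeegnerHypothesis (W.conductorNorm ℤ) K)
    (hsplit : ((Ideal.span {(p : ℤ)}).primesOver (𝓞 K)).ncard = 2)
    (hvbar : ((p : ℕ) : 𝓞 K) ∈ vbar.asIdeal) (hκ : κ.IsAnticyclotomic)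
    (hSf : ∀ w : HeightOneSpectrum (𝓞 K), w ∈ Sf ↔
      (((W.conductorNorm ℤ : ℤ) : 𝓞 K) ∈ w.asIdeal ∧ ((p : ℕ) : 𝓞 K) ∉ w.asIdeal))
    (S : StableSubgroup (absoluteGaloisGroup K) ((W.baseChange K).geomTorsion ((p : ℕ) : ℤ)))
    (hSub : Nat.card S.Sub = p) (hQuot : Nat.card S.Quot = p)
    (hnon1 : ¬ ∀ g ∈ decomp vbar, ∀ x : S.Sub, g • x = x) (hnon2 : ¬ ∀ g ∈ decomp vbar, ∀ y : S.Quot, g • y = y)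
    (hωS : ¬ ∀ g ∈ decomp vbar, ∀ m : S.Sub,
      g • m = ((modNCyclotomicCharacter K p g : (ZMod p)ˣ) : ZMod p).val • m)
    (hωQ : ¬ ∀ g ∈ decomp vbar, ∀ m : S.Quot,
      g • m = ((modNCyclotomicCharacter K p g : (ZMod p)ˣ) : ZMod p).val • m)
    (θsub θquot : FramedGaloisRep K (padicCoeffIntegers (∅ : Set (PadicAlgCl p))) 1)
    (hθsub : ∀ σ : absoluteGaloisGroup K, θsub σ ^ (p - 1) = 1)
    (hθquot : ∀ σ : absoluteGaloisGroup K, θquot σ ^ (p - 1) = 1)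
    (jsub : S.Sub →+ charModule (∅ : Set (PadicAlgCl p)) θsub)
    (hjsub : ∀ (σ : absoluteGaloisGroup K) (a : S.Sub), jsub (σ • a) = σ • jsub a) (hjsub_inj : Function.Injective jsub)
    (hjsub_range : ∀ x : charModule (∅ : Set (PadicAlgCl p)) θsub, x ∈ jsub.range ↔ p • x = 0)
    (jquot : S.Quot →+ charModule (∅ : Set (PadicAlgCl p)) θquot)
    (hjquot : ∀ (σ : absoluteGaloisGroup K) (a : S.Quot), jquot (σ • a) = σ • jquot a)
    (hjquot_inj : Function.Injective jquot)
    (hjquot_range : ∀ x : charModule (∅ : Set (PadicAlgCl p)) θquot, x ∈ jquot.range ↔ p • x = 0)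
    (Dsub : GrDualData κ (charModule (∅ : Set (PadicAlgCl p)) θsub) vbar (↑Sf : Set (HeightOneSpectrum (𝓞 K))) γ)
    (Dquot : GrDualData κ (charModule (∅ : Set (PadicAlgCl p)) θquot) vbar (↑Sf : Set (HeightOneSpectrum (𝓞 K))) γ) :
    p ^ lambdaInvariant p (XAc (W.baseChange K) p κ vbar (↑Sf : Set (HeightOneSpectrum (𝓞 K))) γ) *
          Nat.card {x : XAc (W.baseChange K) p κ vbar (↑Sf : Set (HeightOneSpectrum (𝓞 K))) γ // p • x = 0} =
        p ^ (lambdaInvariant p Dsub.X + lambdaInvariant p Dquot.X) ∧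
      lambdaInvariant p (XAc (W.baseChange K) p κ vbar (↑Sf : Set (HeightOneSpectrum (𝓞 K))) γ) ≤
        lambdaInvariant p Dsub.X + lambdaInvariant p Dquot.X ∧
      ((∀ x : XAc (W.baseChange K) p κ vbar (↑Sf : Set (HeightOneSpectrum (𝓞 K))) γ, p • x = 0 → x = 0) →
        lambdaInvariant p (XAc (W.baseChange K) p κ vbar (↑Sf : Set (HeightOneSpectrum (𝓞 K))) γ) =
          lambdaInvariant p Dsub.X + lambdaInvariant p Dquot.X) := by
  have hpp : p.Prime := hp.out
  have hp2' : p ≠ 2 := by omega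
  haveI hEK : (W.baseChange K).IsElliptic := inferInstanceAs (W.map (algebraMap ℚ K)).IsElliptic
  obtain ⟨hS₀mem, hgood⟩ := sf_split_and_good (p := p) W K Sf hH hSf
  have hS₀fin : (↑Sf : Set (HeightOneSpectrum (𝓞 K))).Finite := Sf.finite_toSet
  -- unramifiedness of `S`, `E_K[p]/S` outside `Sf ∪ {w ∣ p}`, transported to the two character modules
  have hunrE : ∀ w : HeightOneSpectrum (𝓞 K), w ∉ (↑Sf : Set (HeightOneSpectrum (𝓞 K))) → ((p : ℕ) : 𝓞 K) ∉ w.asIdeal →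
      ∀ x ∈ inertia w, ∀ m : (W.baseChange K).geomTorsion ((p : ℕ) : ℤ), x • m = m :=
    fun w hw hpw x hx m ↦ smul_geomTorsion_eq_of_mem_inertia_chosen (W.baseChange K) (hgood w hw hpw) hpw hx m
  have hunrSub : ∀ w : HeightOneSpectrum (𝓞 K), w ∉ (↑Sf : Set (HeightOneSpectrum (𝓞 K))) → ((p : ℕ) : 𝓞 K) ∉ w.asIdeal →
      ∀ x ∈ inertia w, ∀ m : charModule (∅ : Set (PadicAlgCl p)) θsub, p • m = 0 → x • m = m :=
    fun w hw hpw ↦ (forall_smul_eq_iff_of_embedding θsub jsub hjsub hjsub_inj hjsub_range (inertia w)).mp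
      fun x hx a ↦ S.incl_injective (by rw [StableSubgroup.incl_smul]; exact hunrE w hw hpw x hx _)
  have hunrQuot : ∀ w : HeightOneSpectrum (𝓞 K), w ∉ (↑Sf : Set (HeightOneSpectrum (𝓞 K))) → ((p : ℕ) : 𝓞 K) ∉ w.asIdeal →
      ∀ x ∈ inertia w, ∀ m : charModule (∅ : Set (PadicAlgCl p)) θquot, p • m = 0 → x • m = m :=
    fun w hw hpw ↦ (forall_smul_eq_iff_of_embedding θquot jquot hjquot hjquot_inj hjquot_range (inertia w)).mp
      fun x hx a ↦ by
        obtain ⟨n, rfl⟩ := S.proj_surjective a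
        rw [StableSubgroup.smul_proj, hunrE w hw hpw x hx]
  -- the four local hypotheses at `v̄`, transported
  have hne1sub := fun h ↦ hnon1 ((forall_smul_eq_iff_of_embedding θsub jsub hjsub hjsub_inj hjsub_range (decomp vbar)).mpr h)
  have hne1quot := fun h ↦ hnon2 ((forall_smul_eq_iff_of_embedding θquot jquot hjquot hjquot_inj hjquot_range (decomp vbar)).mpr h)
  have hneωsub := fun h ↦
    hωS ((forall_smul_eq_cyclotomic_iff_of_embedding θsub jsub hjsub hjsub_inj hjsub_range (decomp vbar)).mpr h)
  have hneωquot := fun h ↦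
    hωQ ((forall_smul_eq_cyclotomic_iff_of_embedding θquot jquot hjquot hjquot_inj hjquot_range (decomp vbar)).mpr h)
  -- CGLS Prop. 1.2.5 for the two characters
  obtain ⟨hfgsub, hTsub, hμsub, hdimsub⟩ := hprop125 K p hK hp2' hsplit κ hκ γ hγ.out vbar hvbar θsub hθsub
    (↑Sf : Set (HeightOneSpectrum (𝓞 K))) hS₀fin hS₀mem hunrSub hne1sub hneωsub Dsub
  obtain ⟨hfgquot, hTquot, hμquot, hdimquot⟩ := hprop125 K p hK hp2' hsplit κ hκ γ hγ.out vbar hvbar θquot hθquot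
    (↑Sf : Set (HeightOneSpectrum (𝓞 K))) hS₀fin hS₀mem hunrQuot hne1quot hneωquot Dquot
  haveI := hfgsub
  haveI := hfgquot
  -- `ℤ_p`-freeness from the dimension clause and the count `p^λ · #𝔛[p] = #H¹_Gr[p]`
  have hfree : ∀ {θ : FramedGaloisRep K (padicCoeffIntegers (∅ : Set (PadicAlgCl p))) 1}
      (D : GrDualData κ (charModule (∅ : Set (PadicAlgCl p)) θ) vbar (↑Sf : Set (HeightOneSpectrum (𝓞 K))) γ)
      [Module.Finite (IwasawaAlgebra p) D.X],
      Module.IsTorsion (IwasawaAlgebra p) D.X → muInvariant p D.X = 0 →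
      Nat.card {s : grSelmer κ (charModule (∅ : Set (PadicAlgCl p)) θ) vbar (↑Sf : Set (HeightOneSpectrum (𝓞 K))) //
          p • s = 0} = p ^ lambdaInvariant p D.X →
      ∀ x : D.X, p • x = 0 → x = 0 := by
    intro θ D _ hT hμ hdim
    have hcount := CharResidualStrictSelmerCount.GrDualData.pow_lambdaInvariant_mul_natCard_pTorsion_eq D hT hμ
    rw [hdim] at hcount
    have hone : Nat.card {x : D.X // p • x = 0} = 1 := by
      have hpos : 0 < p ^ lambdaInvariant p D.X := pow_pos hpp.pos _
      have := Nat.eq_of_mul_eq_mul_left hpos (hcount.trans (mul_one _).symm)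
      exact this
    obtain ⟨hsub, -⟩ := Nat.card_eq_one_iff_unique.mp hone
    intro x hx
    have := hsub.elim ⟨x, hx⟩ ⟨0, smul_zero _⟩
    exact congrArg Subtype.val this
  have hfreesub := hfree Dsub hTsub hμsub hdimsub
  have hfreequot := hfree Dquot hTquot hμquot hdimquot
  exact lambdaInvariant_le_add_of_grDualData_of_cor126 hlift hlocal W K vbar κ γ Sf hp2 hK hH hsplit hvbar hκ hSf S hSub hQuot
    hnon1 hnon2 hωS θsub θquot hθsub hθquot jsub hjsub hjsub_inj hjsub_range jquot hjquot hjquot_inj hjquot_range Dsub Dquot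
    hTsub hμsub hTquot hμquot hfreesub hfreequot

/-! ### §3 Keyed on a residual pair of `E_K[p]` (the x1 cell's currency) -/

/-- **CGLS22 Prop. 1.2.5 + Cor. 1.2.6 [PUBLISHED] ⟹ `λ(𝔛^{Sf}_f) ≤ λ(𝔛^{Sf}_{θsub}) + λ(𝔛^{Sf}_{θquot})`, with equality if
`𝔛^{Sf}_f` has no `p`-torsion, at a RESIDUAL PAIR `(θsub, θquot)` of `E_K[p]` whose two residual characters avoid `{𝟙, ω}` at `v̄`**
(`KellerYin2024.IsResidualPairOver (W.baseChange K) p θsub θquot`; the local hypotheses are stated on the `p`-torsion of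
`(F/𝒪)(θsub)`, `(F/𝒪)(θquot)` exactly as in the named facts; `𝔛^{Sf}_θ = D.X` for ANY strict dual data; datum as in §2). Keller–Yin
Thm. 1.4.1: «If `φ|_{G_p} = ω` … `λ(𝔛^S_f) = λ(𝔛^S_φ) + λ(𝔛^S_ψ)`»; here the CGLS regime `φ|_{G_p} ≠ 𝟙, ω` (good non-anomalous
or non-split multiplicative `p`) with the equality's one E-level input («`𝔛^{Sf}_f` has no finite part», CGLS Cor. 1.4.3) kept as a
hypothesis. §2 applied to the stable line of `ResidualPairStableLine.exists_stableLine_of_isResidualPairOver`, the local hypotheses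
transferred by §1. [cite: KellerYin2024, Thm. 1.4.1 and §1.4 display (char to f) (arXiv:2402.12781v2 TeX L1063–1098)]
[cite: CastellaGrossiLeeSkinner2022, §1.2 Prop. 1.2.5, Cor. 1.2.6, §1.4 Props. 1.4.1–1.4.2, Cor. 1.4.3 (e-print TeX L681–905)] -/
theorem lambdaInvariant_le_add_of_isResidualPairOver
    (hprop125 : prop125_characterGrSelmerDual_torsion_muZero_dim)
    (hlift : cor126_residualCharacter_globalLift) (hlocal : cor126_residualCharacter_localSurjective)
    (W : WeierstrassCurve ℚ) [W.IsElliptic]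
    (K : Type) [Field K] [NumberField K] (vbar : HeightOneSpectrum (𝓞 K))
    (κ : ZpExtension K p) (γ : absoluteGaloisGroup K) [Fact (κ.IsTopGenerator γ)]
    (Sf : Finset (HeightOneSpectrum (𝓞 K)))
    (hp2 : 2 < p) (hK : IsImaginaryQuadratic K) (hH : SatisfiesHeegnerHypothesis (W.conductorNorm ℤ) K)
    (hsplit : ((Ideal.span {(p : ℤ)}).primesOver (𝓞 K)).ncard = 2)
    (hvbar : ((p : ℕ) : 𝓞 K) ∈ vbar.asIdeal) (hκ : κ.IsAnticyclotomic)
    (hSf : ∀ w : HeightOneSpectrum (𝓞 K), w ∈ Sf ↔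
      (((W.conductorNorm ℤ : ℤ) : 𝓞 K) ∈ w.asIdeal ∧ ((p : ℕ) : 𝓞 K) ∉ w.asIdeal))
    (θsub θquot : FramedGaloisRep K (padicCoeffIntegers (∅ : Set (PadicAlgCl p))) 1)
    (hpair : IsResidualPairOver (W.baseChange K) p θsub θquot)
    (hne1sub : ¬ ∀ g ∈ decomp vbar, ∀ m : charModule (∅ : Set (PadicAlgCl p)) θsub, p • m = 0 → g • m = m)
    (hneωsub : ¬ ∀ g ∈ decomp vbar, ∀ m : charModule (∅ : Set (PadicAlgCl p)) θsub, p • m = 0 →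
      g • m = ((modNCyclotomicCharacter K p g : (ZMod p)ˣ) : ZMod p).val • m)
    (hne1quot : ¬ ∀ g ∈ decomp vbar, ∀ m : charModule (∅ : Set (PadicAlgCl p)) θquot, p • m = 0 → g • m = m)
    (hneωquot : ¬ ∀ g ∈ decomp vbar, ∀ m : charModule (∅ : Set (PadicAlgCl p)) θquot, p • m = 0 →
      g • m = ((modNCyclotomicCharacter K p g : (ZMod p)ˣ) : ZMod p).val • m)
    (Dsub : GrDualData κ (charModule (∅ : Set (PadicAlgCl p)) θsub) vbar (↑Sf : Set (HeightOneSpectrum (𝓞 K))) γ)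
    (Dquot : GrDualData κ (charModule (∅ : Set (PadicAlgCl p)) θquot) vbar (↑Sf : Set (HeightOneSpectrum (𝓞 K))) γ) :
    p ^ lambdaInvariant p (XAc (W.baseChange K) p κ vbar (↑Sf : Set (HeightOneSpectrum (𝓞 K))) γ) *
          Nat.card {x : XAc (W.baseChange K) p κ vbar (↑Sf : Set (HeightOneSpectrum (𝓞 K))) γ // p • x = 0} =
        p ^ (lambdaInvariant p Dsub.X + lambdaInvariant p Dquot.X) ∧
      lambdaInvariant p (XAc (W.baseChange K) p κ vbar (↑Sf : Set (HeightOneSpectrum (𝓞 K))) γ) ≤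
        lambdaInvariant p Dsub.X + lambdaInvariant p Dquot.X ∧
      ((∀ x : XAc (W.baseChange K) p κ vbar (↑Sf : Set (HeightOneSpectrum (𝓞 K))) γ, p • x = 0 → x = 0) →
        lambdaInvariant p (XAc (W.baseChange K) p κ vbar (↑Sf : Set (HeightOneSpectrum (𝓞 K))) γ) =
          lambdaInvariant p Dsub.X + lambdaInvariant p Dquot.X) := by
  haveI hEK : (W.baseChange K).IsElliptic := inferInstanceAs (W.map (algebraMap ℚ K)).IsElliptic
  obtain ⟨S, hSub, hQuot, ⟨jsub, hjsub, hjsub_inj, hjsub_range⟩, ⟨jquot, hjquot, hjquot_inj, hjquot_range⟩⟩ :=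
    ResidualPairStableLine.exists_stableLine_of_isResidualPairOver (W.baseChange K) hpair
  have hθsub : ∀ σ : absoluteGaloisGroup K, θsub σ ^ (p - 1) = 1 := fun σ ↦ (hpair.pow_sub_one σ).1
  have hθquot : ∀ σ : absoluteGaloisGroup K, θquot σ ^ (p - 1) = 1 := fun σ ↦ (hpair.pow_sub_one σ).2
  have hnon1 : ¬ ∀ g ∈ decomp vbar, ∀ x : S.Sub, g • x = x := fun h ↦
    hne1sub ((forall_smul_eq_iff_of_embedding θsub jsub hjsub hjsub_inj hjsub_range (decomp vbar)).mp h)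
  have hnon2 : ¬ ∀ g ∈ decomp vbar, ∀ y : S.Quot, g • y = y := fun h ↦
    hne1quot ((forall_smul_eq_iff_of_embedding θquot jquot hjquot hjquot_inj hjquot_range (decomp vbar)).mp h)
  have hωS : ¬ ∀ g ∈ decomp vbar, ∀ m : S.Sub,
      g • m = ((modNCyclotomicCharacter K p g : (ZMod p)ˣ) : ZMod p).val • m := fun h ↦
    hneωsub ((forall_smul_eq_cyclotomic_iff_of_embedding θsub jsub hjsub hjsub_inj hjsub_range (decomp vbar)).mp h)
  have hωQ : ¬ ∀ g ∈ decomp vbar, ∀ m : S.Quot,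
      g • m = ((modNCyclotomicCharacter K p g : (ZMod p)ˣ) : ZMod p).val • m := fun h ↦
    hneωquot ((forall_smul_eq_cyclotomic_iff_of_embedding θquot jquot hjquot hjquot_inj hjquot_range (decomp vbar)).mp h)
  exact lambdaInvariant_le_add_of_prop125_of_cor126 hprop125 hlift hlocal W K vbar κ γ Sf hp2 hK hH hsplit hvbar hκ hSf S hSub
    hQuot hnon1 hnon2 hωS hωQ θsub θquot hθsub hθquot jsub hjsub hjsub_inj hjsub_range jquot hjquot hjquot_inj hjquot_range
    Dsub Dquot

end Summit.BirchSwinnertonDyer.BirchSwinnertonDyer.Theorems.ResidualDevissageNonsplitLambdaIdentityOfFacts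

end
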